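import Literature.Probability.RandomPlanarGeometry.ConformalRestrictionLocal
import Literature.Probability.RandomPlanarGeometry.SLERestrictionLocal
import Literature.Probability.RandomPlanarGeometry.LoewnerSlitTheorem
import HarnessLib

/-!
# `LawlerSchrammWerner2003` at `κ = 8/3` from THREE leaf facts

Proof-only assembly (no new named fact). G. F. Lawler, O. Schramm, W. Werner, *Conformal
restriction: the chordal case*, J. Amer. Math. Soc. **16** (2003), p. 5, result 2: chordal
SLE_{8/3} is the unique chordal restriction measure on simple curves (the named fact
`LawlerSchrammWerner2003` of `ConformalRestriction.lean`, transposed to Dobrushin domains).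

`ConformalRestrictionLocal.LawlerSchrammWerner2003_of_local_leaf_facts'` derived it from six
leaf facts. Three of them are theorems by now:

* Loewner's slit theorem behind the density clause of [LSW] Lemma 3.5
  (`IsArcHull.exists_loewner_chain_holds`, `LoewnerSlitTheorem`);
* [LSW] Lemma 6.3 (`restrictionDerivVanishesAtHit_of_stolz` with `IsSmoothHull.hitPath_stolz_holds`,
  `SLERestrictionHitReduction` / `SLERestrictionHitStolz`);
* the transience of the SLE trace, which was threaded as Rohde–Schramm's Thm. 7.1 for ALL `κ`
  (`tendsto_norm_sleTrace_atTop`, hiding the SLE₈ trace theorem) and is now, at `κ = 8/3`, the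
  theorem `tendsto_norm_sleTrace_atTop_eightThirds_of_hasSLETrace` (`SLETransienceLocal`), the
  proof of [LSW] Thm. 6.1 being re-threaded accordingly in `SLERestrictionLocal`.

Hence:

* `LawlerSchrammWerner2003_unique_of_five_eighths` — the uniqueness half from [LSW] Thm. 7.3 /
  Cor. 8.6 alone (`IsRestrictionMeasure.eq_five_eighths_of_outer_simple`);
* `LawlerSchrammWerner2003_of_local_leaf_facts''` — **[LSW] p. 5 result 2 from THREE named
  facts**: `HasSLETrace (8/3)` (Rohde–Schramm (2005), Thm. 5.1 at `κ = 8/3`),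
  `sle_exists_isRestrictionMartingale` ([LSW] Prop. 5.2 with Prop. 5.3: the restriction
  martingale `h_t'(W_t)^{5/8}`) and `IsRestrictionMeasure.eq_five_eighths_of_outer_simple`
  ([LSW] Thm. 7.3 / Cor. 8.6: a restriction measure on simple curves has exponent `5/8`);
* `LawlerSchrammWerner2003_of_cor35` — the same with `HasSLETrace (8/3)` fed by Rohde–Schramm's
  one-point derivative estimate Cor. 3.5 on the canonical space (`RohdeSchramm2005_cor35`, to
  which the tree reduces Thm. 5.1 for `κ ≠ 8`: `hasSLETrace_of_ne_eight_of_cor35`).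

## References

* G. F. Lawler, O. Schramm, W. Werner, *Conformal restriction: the chordal case*, J. Amer. Math.
  Soc. **16** (2003), arXiv:math/0209343: p. 5 result 2; Prop. 3.3, Lemma 3.5, Prop. 5.2/5.3,
  Thm. 6.1, Lemma 6.3, Thm. 7.3, Cor. 8.6. [LawlerSchrammWerner2003Restriction]
* S. Rohde, O. Schramm, *Basic properties of SLE*, Ann. of Math. 161 (2005): Cor. 3.5,
  Thms. 5.1, 6.1, 7.1.
-/

noncomputable section

open MeasureTheory Filter Topology
open scoped NNReal

namespace Literature.Probability.RandomPlanarGeometry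

/-- **The uniqueness theorem of [LSW] from Thm. 7.3 / Cor. 8.6 alone**: two chordal restriction
families on simple curves sharing their value in one Dobrushin domain agree everywhere
(`LawlerSchrammWerner2003_unique`), by `LawlerSchrammWerner2003_unique_of_loewner`
(`ConformalRestrictionLocal`) with Loewner's slit theorem behind the density clause of Lemma 3.5
supplied by its proof (`IsArcHull.exists_loewner_chain_holds`, `LoewnerSlitTheorem`).
[cite: LawlerSchrammWerner2003Restriction, Prop. 3.3, Lemma 3.5, Thm. 7.3, Cor. 8.6] -/
theorem LawlerSchrammWerner2003_unique_of_five_eighths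
    (h58 : IsRestrictionMeasure.eq_five_eighths_of_outer_simple) : LawlerSchrammWerner2003_unique :=
  LawlerSchrammWerner2003_unique_of_loewner IsArcHull.exists_loewner_chain_holds h58

/-- **[LSW] p. 5 result 2 (transposed) from THREE leaf facts.** `LawlerSchrammWerner2003` —
chordal SLE_{8/3} is the unique chordal, conformally covariant family of laws on simple curves
with the restriction property — follows from: SLE_{8/3} is generated by a curve (`hgen`,
Rohde–Schramm (2005), Thm. 5.1 at `κ = 8/3`); the restriction martingale `h_t'(W_t)^{5/8}` of
SLE_{8/3} exists (`hM`, [LSW] Prop. 5.2 with Prop. 5.3); and a restriction measure supported on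
simple curves has exponent `5/8` (`h58`, [LSW] Thm. 7.3 / Cor. 8.6). Everything else in the
printed proof and in its transposition to Dobrushin domains is a theorem of the tree: existence
of SLE_{8/3} curves in every Dobrushin domain (`exists_isSLECurve_at`, with transience
`tendsto_norm_sleTrace_atTop_eightThirds_of_hasSLETrace` and simplicity
`ae_isSimpleTrace_sleTrace_eightThirds_of_hasSLETrace` of the trace, Rohde–Schramm Thms. 7.1,
6.1), [LSW] Thm. 6.1 transposed (`IsSLELaw.hullRestriction_eightThirds_of_hasSLETrace`: Lemmas
6.2, 6.3, 2.1, 3.5, Prop. 3.3, §2), the uniqueness theorem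
(`LawlerSchrammWerner2003_unique_of_five_eighths`: Loewner's slit theorem, Prop. 3.3, Thm. 7.3
reduction), Riemann mapping, Carathéodory, the Jordan curve theorem, Kolmogorov extension and
uniqueness in law of chordal SLE.
[cite: LawlerSchrammWerner2003Restriction, p. 5 result 2 with Prop. 3.3, Lemma 3.5, Prop. 5.2, Lemma 6.3, Thm. 6.1, Thm. 7.3, Cor. 8.6] -/
theorem LawlerSchrammWerner2003_of_local_leaf_facts'' (hgen : HasSLETrace ((8 : ℝ≥0) / 3))
    (hM : sle_exists_isRestrictionMartingale)
    (h58 : IsRestrictionMeasure.eq_five_eighths_of_outer_simple) : LawlerSchrammWerner2003 :=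
  LawlerSchrammWerner2003_of_facts_at
    (fun D ↦ exists_isSLECurve_at hgen (tendsto_norm_sleTrace_atTop_eightThirds_of_hasSLETrace hgen) D)
    (LawlerSchrammWerner2003_unique_of_five_eighths h58)
    (IsSLELaw.hullRestriction_eightThirds_of_hasSLETrace hgen hM)
    (ae_isSimpleTrace_sleTrace_eightThirds_of_hasSLETrace hgen)

/-- **[LSW] p. 5 result 2 (transposed) from Rohde–Schramm's Cor. 3.5, [LSW] Prop. 5.2/5.3 and
[LSW] Thm. 7.3 / Cor. 8.6** — as `LawlerSchrammWerner2003_of_local_leaf_facts''`, with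
`HasSLETrace (8/3)` supplied by Rohde–Schramm's Thm. 5.1 for `κ ≠ 8`, which the tree reduces to
the one-point derivative estimate Cor. 3.5 on the canonical space
(`hasSLETrace_of_ne_eight_of_cor35`, `SLETraceContinuity`).
[cite: LawlerSchrammWerner2003Restriction, p. 5 result 2; RohdeSchramm2005, Cor. 3.5 and Thm. 5.1] -/
theorem LawlerSchrammWerner2003_of_cor35 (h35 : RohdeSchramm2005_cor35 Process.preWienerMeasure)
    (hM : sle_exists_isRestrictionMartingale)
    (h58 : IsRestrictionMeasure.eq_five_eighths_of_outer_simple) : LawlerSchrammWerner2003 :=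
  LawlerSchrammWerner2003_of_local_leaf_facts'' (hasSLETrace_of_ne_eight_of_cor35 h35 (by norm_num))
    hM h58

end Literature.Probability.RandomPlanarGeometry

end
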